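import Summits.QuantumFields.BalabanUV.T4Continuum.Support.RegionGaugeSlice
import Summits.QuantumFields.BalabanUV.T4Continuum.Support.RegionScalarCompression

/-!
# T⁴ programme, spine node NE2 (U1a), sub-row Δ1 «NE2⁰-Dirichlet» — THE [B9]-FAITHFUL `U = 1` REGION VECTOR OPERATOR TYPED:
# `Δ_a(Ω₀) = Ω₀(∂*∂)Ω₀ + ∂_Ω·R(Ω₀)·∂_Ω* + a·Ω₀(Q*Q)Ω₀` on the STAR bonds of a union of unit blocks, with the region's OWN gauge
# projection `R(Ω₀)` of (3.25); its `SliceData` PROVED, hence «`G(Ω₀) = Δ_a(Ω₀)⁻¹` exists with `‖G(Ω₀)‖ ≤ max(2/c, 2γ′⁻¹)`» from ONE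
# displayed slice inequality

NE2 formalisation swarm `b2b-balaban-t4-ne2-formalise-*`, leaf 07 (gen 5), supplier item «Δ1-COERC», file 3 (files 1–2:
`Support/RegionGaugeSlice` p222530 — the abstract reduction; `Support/RegionScalarCompression` p222542 — the uniform bound on
`(Q′_ΩG′_Ω²Q′_Ω*)⁻¹`).  Owner rulings R21 (e) / R22 (c) (journal 2026-08-20 l.14713 / l.≈15480): the lineage's Δ1 vector tower
`DirichletRegionTower.DalevR` COMPRESSES the TORUS operator (gauge projection of the whole torus), whereas [Balaban1985BackgroundPropagators]
(3.26)–(3.27) p.395 «Δ_a = Δ + DRD* + Q*aQ … Δ_a↾Ω₀ = Ω₀Δ_aΩ₀ … G(U) = G = (Δ_a↾Ω₀)⁻¹» builds the gauge term from THE REGION's projection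
«R = I − G′Q′*(Q′G′²Q′*)⁻¹Q′G′, G′ = (Δ′_a)⁻¹» (3.25), `Δ′_a = (Δ^η_U + Q′*aQ′)↾Ω₀` (3.24); «the [B9]-faithful vector region operator … NOT
typed: its coercivity on Ω₀ is OPEN» (R22 (c)).  THIS FILE TYPES IT at `U = 1` (one region, one averaging scale, model level) and proves
the structural identities of `RegionGaugeSlice.SliceData` for it:

 * §1 CONVENTION (stated, ours): the region's vector fields live on the STAR bonds `starReg S = {(x,ν) : x ∈ Ω ∨ x + e_ν ∈ Ω}` of
   `Ω = blockReg n M S` — exactly the bonds on which the gradient of a scalar supported in `Ω` can be non-zero ([B9] p.393 «Dirichlet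
   boundary conditions on Ω₀ᶜ»: a field vanishes on every bond INSIDE `Ω₀ᶜ`); so the region gradient `gradR = (∂)_{VΩ}` of a Dirichlet
   scalar IS its torus gradient, `gradRᴴ·gradR = (−Δ)_{ΩΩ}` EXACTLY (`gradR_conjTranspose_mul_gradR`), and the torus curl of the
   zero-extension sees every plaquette touching the region (`curlR`, scaled by `2^{−1/2}` because the tree's `CurlOp` runs over ORDERED pairs:
   `curlRᴴ·curlR = (Δ − ∂∂ᴴ)_{VV}` = «∂*∂», `curlR_conjTranspose_mul_curlR`).
 * §2 THE STRUCTURAL IDENTITIES: `curlR·gradR = 0` (curl ∘ grad on the torus, `CurlOp_mulVec_GradOp`); `avgR·gradR = grad₁R·QOm`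
   ([Balaban1984PropagatorsI] (1.55) «Q∂ = ∂₁Q′», tree `B5Block118.QvOp_gaugeT_eq` / `B5Hk160Torus.QvOp_GradOp_mulVec`, read through the region: `Q′` never couples a block
   outside `S` to a site of `Ω`); `QOm λ = 0 → DOm λ = gradRᴴ(gradR λ)` (road P2's `DOm = (−Δ + a′Π′)_{ΩΩ}` and `Π′_{ΩΩ} = n^d·QOmᴴQOm`);
   with `GOm`/`isUnit_det_gramK_region` of file 2: **`sliceData_region`** `: SliceData curlR gradR DOm GOm QOm avgR grad₁R`.
 * §3 THE OPERATOR **`regionDeltaA n M a a′ S := gaugeFixed curlR gradR GOm QOm avgR (a·n^d)`** (coupling `a·n^d` because the tree's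
   `Q*aQ` is `a·Q_adj·Q = a·n^d·QᴴQ`, `B5Block118`), its form `‖curl A‖²/… + ‖R(Ω₀)·∂_Ω*A‖² + a n^d‖QA‖²`, and the ENDs from file 1 BY NAME:
   **`opNorm_inv_regionDeltaA_le_of_slice (hS : SliceCoercive curlR gradR GOm QOm avgR (a·n^d) c) : ‖(regionDeltaA …)⁻¹‖ ≤
   (min (c/2) (1/(2γ′⁻¹)))⁻¹`** (γ′ = `gammaPs d a′`, road P2's `opNorm_inv_DOm_le`), `isUnit_det_regionDeltaA_of_slice`, and the
   converse `sliceCoercive_region_of_coercive`.  The ONE displayed hypothesis `SliceCoercive …` («the gauge-invariant form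
   `‖curl A‖² + a n^d‖QA‖²` is `c`-coercive on Bałaban's slice `{R(Ω₀)·∂_Ω*A = 0}`») is the located open estimate of O12-c (iii)
   (census `t4/T4-EST-NE2-D1-COERC.md`: a discrete Gaffney/Maxwell-type gap for the electric realisation; in print with a
   DOMAIN-DEPENDENT constant for edge elements, not uniformly in the region).

RELATION TO THE LINEAGE's MODEL (owner ruling R23 (b), located delta G-ne2p1-g12-1 in kernel-adjacent words).  Gen 11's
`DirichletRegionTower.DalevR S₀ k = (calDalev k).toBlock …` compresses B5's TORUS operator `Δ − ∂P_T∂ᴴ + a·Q_adj·Q` to SITE-based bonds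
(all components of the sites of the region).  `regionDeltaA` has the SAME Wilson part `(Δ − ∂∂ᴴ)_{VV}` and the SAME mass part
`a·n^d·(QᴴQ)_{VV}` up to the bond convention (STAR bonds here), and a DIFFERENT gauge part: the REGION's co-projection
`1 − gaugeP (GOm) (QOm)` sandwiched by the REGION gradient, `∂_Ω·R(Ω₀)·∂_Ωᴴ`, versus the compressed torus term `(∂·(1 − PcT)·∂ᴴ)_{VV}`
with B5's torus co-projection `PcT`; the two coincide iff the region is the whole torus.  Consequence recorded in the census
`t4/T4-EST-NE2-D1-COERC.md`: the compressed torus operator inherits B5 (1.90) (it dominates `γ·(∇ᴴ∇ + 1)` on the region — BOTH tangential and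
normal boundary components are penalised), the faithful one does NOT dominate `∇ᴴ∇` uniformly in `η` on regions with re-entrant edges
(pure-gauge corner mode), although its `L²`-coercivity is expected (electric boundary condition: tangential components only).

HONEST FRAMING (T4-DAG p. 1).  `U = 1`; ONE region, ONE averaging scale (no `{Λ_j, a_j}`, no η-scale collar mass of [B9] (3.16) j = 0);
finite torus; operator norm; statements / conventions / constants OURS ([folklore] over landed modules; `[cite:]` tags locate SHAPES);
the slice inequality is DISPLAYED, not proved; NOT [B9] (3.23)–(3.27) as printed; NE2 (U1a) NOT proved; spine 0/9 unchanged; NOT infinite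
volume / mass gap / Clay / summit progress.  HONEST DEPENDENCY: continuum YM on T⁴ ⇐ BetaPertH ∧ nine spine estimates (0/9 proved);
BetaPertH ⇐ (D1) ∧ (D4) ∧ CAP+tail; G-an2-4 gates asym, D1 and NE2/3/4.  No `sorry`.
-/

noncomputable section

open scoped BigOperators ComplexConjugate Matrix Matrix.Norms.L2Operator
open Finset

namespace Summit.QuantumFields.BalabanUV.T4Continuum.RegionGaugeFixedVector

open Literature.MathematicalPhysics.QuantumFieldTheory.Balaban1983to89.B5Prop11Plancherel (Tor fine unitVec opNorm_le_of_sq_le)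
open Literature.MathematicalPhysics.QuantumFieldTheory.Balaban1983to89.B5Prop11Lower (nsq nsq_nonneg Lap)
open Literature.MathematicalPhysics.QuantumFieldTheory.Balaban1983to89.B5Action121 (shiftS sdiff LapS GradOp GradOp_mulVec sdiff_mulVec
  CurlOp CurlOp_mulVec Fs_apply curl_adjoint_curl Lap_eq_LapV GradOp_conjTranspose_mul_GradOp gaugeT)
open Literature.MathematicalPhysics.QuantumFieldTheory.Balaban1983to89.B5Block118 (bpt QsOp QvOp QvOp_gaugeT_eq)
open Literature.MathematicalPhysics.QuantumFieldTheory.Balaban1983to89.B5Blocks16 (blockOf blockOf_bpt)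
open Summit.QuantumFields.BalabanUV.T4Continuum
open Summit.QuantumFields.BalabanUV.T4Continuum.SubtypeCompression (Coercive isUnit_det_of_coercive opNorm_inv_le_of_coercive
  toBlock_add toBlock_smul toBlock_conjTranspose toBlock_mul_of_vanish_right)
open Summit.QuantumFields.BalabanUV.T4Continuum.ScalarBlockPoincare (PiS)
open Summit.QuantumFields.BalabanUV.T4Continuum.ScalarAveragedPropagator (DeltaPs gammaPs gammaPs_pos)
open Summit.QuantumFields.BalabanUV.T4Continuum.RegionGaugeProjection (gramK gaugeP gaugeR)
open Summit.QuantumFields.BalabanUV.T4Continuum.RegionGaugeSlice (gaugeFixed SliceData SliceCoercive coercive_gaugeFixed_of_slice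
  isUnit_det_gaugeFixed_of_slice opNorm_inv_gaugeFixed_le_of_slice sliceCoercive_of_coercive form_gaugeFixed)
open Summit.QuantumFields.BalabanUV.T4Continuum.RegionScalarCompression (QOm GOm GOm_isHermitian GOm_mul_DOm DOm_mul_GOm
  isUnit_det_gramK_region)
open Summit.QuantumFields.BalabanUV.Beta.GAN24.DirichletBoxCompression (DOm isUnit_det_DOm opNorm_inv_DOm_le)
open Summit.QuantumFields.BalabanUV.Beta.GAN24.DirichletBoxTrace (blockReg)

variable {d : ℕ}

/-! ## §1 Torus identities: entries of the gradient, curl ∘ grad, `Q′` off its block -/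

section Torus

variable (N : Fin d → ℕ) [hN : ∀ μ, NeZero (N μ)] (c : ℂ)

omit hN in
/-- the ENTRIES of the gradient: `∂_{(x,ν),y} = c·([y = x + e_ν] − [y = x])`. [folklore] -/
theorem GradOp_apply (b : Tor N × Fin d) (y : Tor N) :
    GradOp N c b y = c * ((if y = b.1 + unitVec N b.2 then 1 else 0) - (if b.1 = y then 1 else 0)) := by
  simp only [GradOp, Literature.MathematicalPhysics.QuantumFieldTheory.Balaban1983to89.B5Action121.sdiff, shiftS,
    Matrix.smul_apply, Matrix.sub_apply, Matrix.one_apply, smul_eq_mul]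

/-- **curl ∘ grad = 0** on the torus: `F_{μν}(∂λ) = 0` (forward differences commute). [cite: Balaban1984PropagatorsI, (1.4) p.18 (shape)] [folklore] -/
theorem CurlOp_mulVec_GradOp (l : Tor N → ℂ) : CurlOp N c *ᵥ (GradOp N c *ᵥ l) = 0 := by
  funext ⟨x, μ, ν⟩
  rw [Pi.zero_apply, CurlOp_mulVec, Fs_apply]
  simp only [GradOp_mulVec, sdiff_mulVec]
  rw [add_right_comm x (unitVec N ν) (unitVec N μ)]
  ring

end Torus

section Blocks

variable (n : ℕ) [NeZero n] (M : Fin d → ℕ) [hM : ∀ μ, NeZero (M μ)]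

/-- `Q′` never couples a block to a site outside it: `Q′_{y,x} = 0` unless `blockOf x = y`. [folklore] -/
theorem QsOp_apply_eq_zero {y : Tor M} {x : Tor (fine n M)} (h : blockOf n M x ≠ y) : QsOp n M y x = 0 := by
  unfold QsOp
  refine Finset.sum_eq_zero fun j _ => ?_
  rw [if_neg]
  intro hx
  exact h (by rw [hx, blockOf_bpt])

end Blocks

/-! ## §2 The region objects on the STAR bonds, and the structural identities -/

section Region

variable (n : ℕ) [NeZero n] (M : Fin d → ℕ) [hM : ∀ μ, NeZero (M μ)] (a a' : ℝ) (S : Tor M → Prop) [DecidablePred S]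

/-- the STAR BONDS of the region: `(x, ν)` with `x ∈ Ω` or `x + e_ν ∈ Ω` — every bond carrying the gradient of a scalar supported in `Ω`
(CONVENTION, ours; [B9] p.393 «Dirichlet boundary conditions on Ω₀ᶜ»: fields vanish on the bonds inside `Ω₀ᶜ`).
[cite: Balaban1985BackgroundPropagators, p.393 (shape)] [folklore] -/
def starReg : Tor (fine n M) × Fin d → Prop := fun b => blockReg n M S b.1 ∨ blockReg n M S (b.1 + unitVec (fine n M) b.2)

/-- decidability of the star predicate. [folklore] -/
instance decStarReg : DecidablePred (starReg n M S) := fun b =>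
  inferInstanceAs (Decidable (blockReg n M S b.1 ∨ blockReg n M S (b.1 + unitVec (fine n M) b.2)))

/-- THE REGION CURL: the torus curl of the zero-extension, read on all plaquettes — scaled by `2^{−1/2}` since `CurlOp` runs over ORDERED
pairs (`curl_adjoint_curl`: `CurlOpᴴCurlOp = 2·(Δ − ∂∂ᴴ)`). [cite: Balaban1984PropagatorsI, (1.2)/(1.21) p.18/21 (shape)] [folklore] -/
def curlR : Matrix (Tor (fine n M) × (Fin d × Fin d)) {b // starReg n M S b} ℂ :=
  (((Real.sqrt 2)⁻¹ : ℝ) : ℂ) • (CurlOp (fine n M) (n : ℂ)).submatrix id Subtype.val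

/-- THE REGION GRADIENT `∂_Ω = (∂)_{VΩ}` from Dirichlet scalars on `Ω` to the star bonds. [cite: Balaban1985BackgroundPropagators, (3.26) p.395 (shape: D)] [folklore] -/
def gradR : Matrix {b // starReg n M S b} {x // blockReg n M S x} ℂ :=
  (GradOp (fine n M) (n : ℂ)).toBlock (starReg n M S) (blockReg n M S)

/-- Bałaban's line-sum vector averaging read on the star bonds (all unit-lattice rows: `Ω₀(Q*Q)Ω₀` keeps every row of `Q`).
[cite: Balaban1984PropagatorsI, (1.18) p.20 (shape)] [folklore] -/
def avgR : Matrix (Tor M × Fin d) {b // starReg n M S b} ℂ := (QvOp n M).submatrix id Subtype.val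

/-- the unit-lattice gradient from the region's blocks. [cite: Balaban1984PropagatorsI, (1.55) p.27 (shape: ∂₁)] [folklore] -/
def grad₁R : Matrix (Tor M × Fin d) {y // S y} ℂ := (GradOp M 1).submatrix id Subtype.val

omit [DecidablePred S] in
/-- the gradient never couples a NON-star bond to a site of `Ω`. [folklore] -/
theorem GradOp_apply_eq_zero_of_not_star {b : Tor (fine n M) × Fin d} (hb : ¬ starReg n M S b) {y : Tor (fine n M)}
    (hy : blockReg n M S y) : GradOp (fine n M) (n : ℂ) b y = 0 := by
  rw [GradOp_apply]
  have h1 : ¬ y = b.1 + unitVec (fine n M) b.2 := fun h => hb (Or.inr (h ▸ hy))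
  have h2 : ¬ b.1 = y := fun h => hb (Or.inl (h ▸ hy))
  rw [if_neg h1, if_neg h2, sub_zero, mul_zero]

/-- a sum over the star bonds of a function vanishing off them is the full sum. [folklore] -/
theorem sum_star_eq {f : Tor (fine n M) × Fin d → ℂ} (hf : ∀ b, ¬ starReg n M S b → f b = 0) :
    ∑ b : {b // starReg n M S b}, f b = ∑ b, f b := by
  rw [← Fintype.sum_subtype_add_sum_subtype (starReg n M S) f]
  have h2 : ∑ b : {b // ¬ starReg n M S b}, f b = 0 := Finset.sum_eq_zero fun b _ => hf b b.2
  rw [h2, add_zero]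

/-- **`gradRᴴ·gradR = (−Δ)_{ΩΩ}` EXACTLY** (the star bonds carry the whole gradient of a Dirichlet scalar).
[cite: Balaban1985BackgroundPropagators, (3.24) p.394 (shape: Δ^η_U↾Ω₀)] [folklore] -/
theorem gradR_conjTranspose_mul_gradR :
    (gradR n M S)ᴴ * gradR n M S = (LapS (fine n M) (n : ℂ)).toBlock (blockReg n M S) (blockReg n M S) := by
  ext x x'
  rw [← GradOp_conjTranspose_mul_GradOp]
  simp only [Matrix.mul_apply, Matrix.conjTranspose_apply, gradR, Matrix.toBlock_apply]
  exact sum_star_eq n M S (f := fun b => star (GradOp (fine n M) (n : ℂ) b x.1) * GradOp (fine n M) (n : ℂ) b x'.1)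
    fun b hb => by rw [GradOp_apply_eq_zero_of_not_star n M S hb x'.2, mul_zero]

/-- `∂ ∘ ∂ = 0` as a matrix identity on the torus. [folklore] -/
theorem CurlOp_mul_GradOp_apply (p : Tor (fine n M) × (Fin d × Fin d)) (y : Tor (fine n M)) :
    (CurlOp (fine n M) (n : ℂ) * GradOp (fine n M) (n : ℂ)) p y = 0 := by
  have h := congrFun (CurlOp_mulVec_GradOp (fine n M) (n : ℂ) (Pi.single y 1)) p
  rwa [Matrix.mulVec_mulVec, Matrix.mulVec_single_one, Matrix.col_apply, Pi.zero_apply] at h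

/-- **`curlR·gradR = 0`**. [folklore] -/
theorem curlR_mul_gradR : curlR n M S * gradR n M S = 0 := by
  ext p x
  rw [Matrix.mul_apply, Matrix.zero_apply]
  simp only [curlR, gradR, Matrix.smul_apply, Matrix.submatrix_apply, Matrix.toBlock_apply, id, smul_eq_mul, mul_assoc]
  rw [← Finset.mul_sum, sum_star_eq n M S (f := fun b => CurlOp (fine n M) (n : ℂ) p b * GradOp (fine n M) (n : ℂ) b x.1)
    fun b hb => by rw [GradOp_apply_eq_zero_of_not_star n M S hb x.2, mul_zero]]
  rw [← Matrix.mul_apply, CurlOp_mul_GradOp_apply, mul_zero]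

omit [DecidablePred S] in
/-- **`curlRᴴ·curlR = (Δ − ∂∂ᴴ)_{VV}`** — «∂*∂» ([B9] (3.26)'s `Δ^η(U)` at `U = 1`) read on the star bonds.
[cite: Balaban1984PropagatorsI, (1.69) p.29 (shape: ∂*∂ = Δ − ∂∂*)] [folklore] -/
theorem curlR_conjTranspose_mul_curlR :
    (curlR n M S)ᴴ * curlR n M S
      = (Lap n M - GradOp (fine n M) (n : ℂ) * (GradOp (fine n M) (n : ℂ))ᴴ).submatrix
          (Subtype.val : {b // starReg n M S b} → _) Subtype.val := by
  have hs : star ((((Real.sqrt 2)⁻¹ : ℝ) : ℂ)) * (((Real.sqrt 2)⁻¹ : ℝ) : ℂ) * 2 = 1 := by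
    rw [Complex.star_def, Complex.conj_ofReal, ← Complex.ofReal_mul, ← sq, inv_pow, Real.sq_sqrt (by norm_num : (0:ℝ) ≤ 2)]
    push_cast; norm_num
  unfold curlR
  rw [Matrix.conjTranspose_smul, Matrix.smul_mul, Matrix.mul_smul, smul_smul, Matrix.conjTranspose_submatrix,
    ← Matrix.submatrix_mul _ _ _ id _ Function.bijective_id, curl_adjoint_curl, Lap_eq_LapV]
  ext i j
  simp only [Matrix.smul_apply, Matrix.submatrix_apply, smul_eq_mul]
  rw [← mul_assoc, hs, one_mul]

/-- «Q∂ = ∂₁Q′» as a matrix identity on the torus. [cite: Balaban1984PropagatorsI, (1.55) p.27] [folklore] -/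
theorem QvOp_mul_GradOp_apply (i : Tor M × Fin d) (y : Tor (fine n M)) :
    (QvOp n M * GradOp (fine n M) (n : ℂ)) i y = (GradOp M 1 * QsOp n M) i y := by
  -- «Q∂ = ∂₁Q′» at the vector `e_y` (the tree's `QvOp_gaugeT_eq` at `A = 0`, = `B5Hk160Torus.QvOp_GradOp_mulVec`)
  have h0 := QvOp_gaugeT_eq n M 0 (Pi.single y 1)
  simp only [gaugeT, zero_sub, Matrix.mulVec_neg, Matrix.mulVec_zero, neg_inj] at h0
  have h := congrFun h0 i
  rwa [Matrix.mulVec_mulVec, Matrix.mulVec_mulVec, Matrix.mulVec_single_one, Matrix.mulVec_single_one, Matrix.col_apply,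
    Matrix.col_apply] at h

/-- **«Q∂ = ∂₁Q′» THROUGH THE REGION**: `avgR·gradR = grad₁R·QOm`. [cite: Balaban1984PropagatorsI, (1.55) p.27] [folklore] -/
theorem avgR_mul_gradR : avgR n M S * gradR n M S = grad₁R M S * QOm n M S := by
  ext i x
  rw [Matrix.mul_apply, Matrix.mul_apply]
  simp only [avgR, gradR, grad₁R, QOm, Matrix.submatrix_apply, Matrix.toBlock_apply, id]
  rw [sum_star_eq n M S (f := fun b => QvOp n M i b * GradOp (fine n M) (n : ℂ) b x.1)
    fun b hb => by rw [GradOp_apply_eq_zero_of_not_star n M S hb x.2, mul_zero]]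
  rw [← Matrix.mul_apply, QvOp_mul_GradOp_apply, Matrix.mul_apply,
    ← Fintype.sum_subtype_add_sum_subtype S (fun y => GradOp M 1 i y * QsOp n M y x.1)]
  have h2 : ∑ y : {y // ¬ S y}, GradOp M 1 i y * QsOp n M y x.1 = 0 :=
    Finset.sum_eq_zero fun y _ => by
      have hx : S (blockOf n M x.1) := x.2
      rw [QsOp_apply_eq_zero n M (fun h => y.2 (by rw [← h]; exact hx)), mul_zero]
  rw [h2, add_zero]

/-- `Π′_{ΩΩ} = n^d·QOmᴴ·QOm` (`Q′` does not couple a block outside `S` to a site of `Ω`). [folklore] -/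
theorem toBlock_PiS : (PiS n M).toBlock (blockReg n M S) (blockReg n M S) = ((n : ℂ) ^ d) • ((QOm n M S)ᴴ * QOm n M S) := by
  unfold PiS QOm
  rw [toBlock_smul, toBlock_mul_of_vanish_right (q := S)]
  · rfl
  · intro y x hy hx
    have hx' : S (blockOf n M x) := hx
    exact QsOp_apply_eq_zero n M (fun h => hy (by rw [← h]; exact hx'))

/-- **on `N(Q′)` the region scalar operator is the Dirichlet Laplacian**: `QOm λ = 0 → DOm λ = gradRᴴ(gradR λ)`.
[cite: Balaban1985BackgroundPropagators, (3.24) p.394 (shape)] [folklore] -/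
theorem DOm_mulVec_of_ker (lam : {x // blockReg n M S x} → ℂ) (h : QOm n M S *ᵥ lam = 0) :
    DOm n M a' (blockReg n M S) *ᵥ lam = (gradR n M S)ᴴ *ᵥ (gradR n M S *ᵥ lam) := by
  rw [Matrix.mulVec_mulVec, gradR_conjTranspose_mul_gradR]
  unfold DOm DeltaPs
  rw [toBlock_add, toBlock_smul, toBlock_PiS, Matrix.add_mulVec, Matrix.smul_mulVec, Matrix.smul_mulVec, ← Matrix.mulVec_mulVec,
    h, Matrix.mulVec_zero, smul_zero, smul_zero, add_zero]

/-- **THE STRUCTURAL IDENTITIES OF `SliceData` HOLD FOR THE REGION OBJECTS** (`0 < a′`).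
[cite: Balaban1985BackgroundPropagators, (3.21)–(3.26) pp.394–395 (shapes)] [folklore] -/
theorem sliceData_region (ha' : 0 < a') :
    SliceData (curlR n M S) (gradR n M S) (DOm n M a' (blockReg n M S)) (GOm n M a' S) (QOm n M S) (avgR n M S) (grad₁R M S) where
  curl_grad := curlR_mul_gradR n M S
  avg_grad := avgR_mul_gradR n M S
  lap_of_ker := DOm_mulVec_of_ker n M a' S
  herm := GOm_isHermitian n M a' S
  G_mul := GOm_mul_DOm n M a' S ha'
  mul_G := DOm_mul_GOm n M a' S ha'
  gram_unit := isUnit_det_gramK_region n M a' S ha'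

/-! ## §3 The operator `Δ_a(Ω₀)` and its inverse from one displayed slice inequality -/

/-- **THE [B9]-FAITHFUL `U = 1` REGION VECTOR OPERATOR** `Δ_a(Ω₀) = (∂*∂)_{VV} + ∂_Ω·R(Ω₀)·∂_Ωᴴ + a·n^d·(QᴴQ)_{VV}` on the star bonds
(coupling `a·n^d`: the tree's `Q*aQ = a·n^d·QᴴQ`). [cite: Balaban1985BackgroundPropagators, (3.26)–(3.27) p.395 (shape)] [folklore] -/
def regionDeltaA : Matrix {b // starReg n M S b} {b // starReg n M S b} ℂ :=
  gaugeFixed (curlR n M S) (gradR n M S) (GOm n M a' S) (QOm n M S) (avgR n M S) (a * (n : ℝ) ^ d)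

/-- unfolding (definitional). [folklore] -/
theorem regionDeltaA_eq : regionDeltaA n M a a' S
    = (curlR n M S)ᴴ * curlR n M S + gradR n M S * gaugeR (GOm n M a' S) (QOm n M S) * (gradR n M S)ᴴ
        + ((a * (n : ℝ) ^ d : ℝ) : ℂ) • ((avgR n M S)ᴴ * avgR n M S) := rfl

/-- its quadratic form: `re⟨A, Δ_a(Ω₀)A⟩ = ‖curlR A‖² + ‖R(Ω₀)·∂_ΩᴴA‖² + a n^d·‖QA‖²`. [cite: Balaban1984PropagatorsI, (1.69) p.29 (shape)] [folklore] -/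
theorem form_regionDeltaA (ha' : 0 < a') (A : {b // starReg n M S b} → ℂ) :
    (star A ⬝ᵥ (regionDeltaA n M a a' S *ᵥ A)).re
      = nsq (curlR n M S *ᵥ A) + nsq (gaugeR (GOm n M a' S) (QOm n M S) *ᵥ ((gradR n M S)ᴴ *ᵥ A))
          + a * (n : ℝ) ^ d * nsq (avgR n M S *ᵥ A) :=
  form_gaugeFixed _ _ _ _ _ _ (GOm_isHermitian n M a' S) (isUnit_det_gramK_region n M a' S ha') A

/-- **«G(Ω₀) EXISTS» FROM ONE SLICE INEQUALITY**: slice coercivity `c` ⟹ `Δ_a(Ω₀)` invertible …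
[cite: Balaban1985BackgroundPropagators, (3.27) p.395 (shape)] [folklore] -/
theorem isUnit_det_regionDeltaA_of_slice (ha' : 0 < a') {c : ℝ} (hc : 0 < c)
    (hS : SliceCoercive (curlR n M S) (gradR n M S) (GOm n M a' S) (QOm n M S) (avgR n M S) (a * (n : ℝ) ^ d) c) :
    IsUnit (regionDeltaA n M a a' S).det :=
  isUnit_det_gaugeFixed_of_slice _ (sliceData_region n M a' S ha') hc hS (opNorm_inv_DOm_le n M a' (blockReg n M S) ha')
    (inv_pos.mpr (gammaPs_pos (d := d) (a' := a')).1)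

/-- **… WITH `‖G(Ω₀)‖ ≤ (min(c/2, γ′/2))⁻¹ = max(2/c, 2γ′⁻¹)`**, `γ′ = gammaPs d a′` — uniform in whatever `c` is uniform in.
[cite: Balaban1985BackgroundPropagators, (3.27) p.395 (shape)] [folklore] -/
theorem opNorm_inv_regionDeltaA_le_of_slice (ha' : 0 < a') {c : ℝ} (hc : 0 < c)
    (hS : SliceCoercive (curlR n M S) (gradR n M S) (GOm n M a' S) (QOm n M S) (avgR n M S) (a * (n : ℝ) ^ d) c) :
    ‖(regionDeltaA n M a a' S)⁻¹‖ ≤ (min (c / 2) (1 / (2 * (gammaPs d a')⁻¹)))⁻¹ :=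
  opNorm_inv_gaugeFixed_le_of_slice _ (sliceData_region n M a' S ha') hc hS (opNorm_inv_DOm_le n M a' (blockReg n M S) ha')
    (inv_pos.mpr (gammaPs_pos (d := d) (a' := a')).1)

/-- and conversely: a coercivity constant of `Δ_a(Ω₀)` IS a slice constant — the displayed inequality is EXACTLY what is open.
[folklore] -/
theorem sliceCoercive_region_of_coercive (ha' : 0 < a') {γ : ℝ} (h : Coercive (regionDeltaA n M a a' S) γ) :
    SliceCoercive (curlR n M S) (gradR n M S) (GOm n M a' S) (QOm n M S) (avgR n M S) (a * (n : ℝ) ^ d) γ :=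
  sliceCoercive_of_coercive _ (GOm_isHermitian n M a' S) (isUnit_det_gramK_region n M a' S ha') h

end Region

end Summit.QuantumFields.BalabanUV.T4Continuum.RegionGaugeFixedVector

end
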